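import Summits.BirchSwinnertonDyer.Rank1Residual.Additive.RamifiedSevenGenusKatoExpDatum
import Literature.NumberTheory.EllipticCurves.Kato2004.IwasawaCohomologyNumberFieldTwistModel
import Literature.NumberTheory.GaloisRepresentations.ContinuousCorestrictionResNormal
import Literature.NumberTheory.EllipticCurves.GaloisActionProofs
import HarnessLib

set_option autoImplicit false

/-!
# `𝒞₇` genus road (crux `EllipticUnitValueSevenOfGZK`, K7r), row K2C-9 (C6a): THE `exp*`-VALUE READING `valOf` OF A
# PINNED FRAME — the TERM inhabiting the field `val` of `KatoExpDatum hγ Φ`, with the value laws (e1′) `ℤ₇`-linearity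
# and (e1) naturality under `γK` PROVED for every class (part 1 of 2; (eV) and (e2) in `…KatoExpReadingValues`)

Cell bsd-cm, seat bsd-cm-prr-ty1 g35 (literature-prover), row K2C-9 (C6a) minted by the pen bsd-cm-plan g37 (D1009 (6),
D1019 (A), D1023 (C)) and the director (739)(2); file (F-A) of this seat's CHECK (STATUS 2026-08-31).  Companion files:
(F-B) `Literature/NumberTheory/EllipticCurves/ZpExtensionArtinExponent.lean` (field (art′)), (F-C)
`RamifiedSevenGenusKatoExpDatumOfLaws.lean` (the constructor `KatoExpDatum.ofLaws`).

## The reading (Kato Prop. 15.9 / (15.9.1), §15.8 (15.8.1); design «(v-tor), Galois action INSIDE `𝔏`»)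

Fix a pinned frame `Φ` (so the CM field `Kcm`, the cyclotomic `ℤ₇`-tower `U_n = Gal(K̄/Kℚ_n)` of `Kcm`, the `K`-side
Iwasawa cohomology `IK` with its layer projections `IK.proj n : IK.H → H¹(U_n, T₇W_K)`, the complex embedding `ιC` of
`K̄`, and ONE dual-exponential value datum `𝔏 = (𝔏_U)_U`, `𝔏_U : H¹(U, T₇W_K) →ₗ[ℤ₇] ℚ₇ ⊗_ℤ K̄`, on which the Prop-15.9 body
`CM.EllipticZetaBody` of the elliptic-unit classes is pinned) and a complex reading `ι₇ : ℚ₇ → ℂ`.  For a continuous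
character `χ` of `Γ_{Kcm}` let `n(χ)` be its least cyclotomic level (`levelOf`; `0` if `χ` has no finite level — `val`
is then unconstrained by every field of the datum), `U := U_{n(χ)}`, and `U′ := Gal(K̄/K(W_K[7^{m}·7d]))` the TORSION
layer inside `U` supplied by the frame's pin `isRayClassLayer_layer` (`torsionLayerAt`; `m = torsionExp`).  Then

  `valOf Φ ι₇ χ x := [U : U′]⁻¹ · Σ_{q ∈ Γ/U′} χ(q̃) · (ι₇ ⊗ ιC)(𝔏_{U′}(q̃ · res_{U′}^{U}(IK.proj n(χ) x)))`,  `q̃ = q.out`,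

i.e. the `χ`-isotypic functional of `exp*` read on the torsion layer, with the Galois action applied to the CLASS (inside
`𝔏`), normalised by the index.  WHY this reading (the scope memo of g34 `DualExpValueDatum-scope.md` §1/§4 and this seat's
CHECK): the body's datum axiom (Z3a) «`𝔏` is `Γ_K`-equivariant» is printed ONLY on the torsion layers
(`EllipticZetaReciprocity` (Z3a)), not on the cyclotomic layers; with the action inside `𝔏`, (e1) `val χ ((1+X)·x) =
χ(γK)⁻¹·val χ x` holds for EVERY class by group cohomology alone (`X` acts as `conj_{γK} − 1` on the layers, `res ∘ conj =
conj ∘ res`, `conj_a ∘ conj_b = conj_{ab}`, inner classes act trivially, re-indexing `Γ/U′` by right translation), and (Z3a)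
is consumed exactly once, in (eV), on the body witness, where `res_{U′}^{U} ∘ cor_{U}^{U′} = Σ_{U/U′} conj` (tree
`resLe_coresLe_eq_sum_conjMap`) produces the index that the normalisation removes.  No level-comparison lemma is needed:
every law is proved at `n(χ)` and the datum's right-hand sides are level-free.

## Contents (all PROVED; definitions with bodies; no instance, no notation, no axiom, no sorry, no named fact)
§0 group-cohomology/finite-sum helpers (re-indexing a sum over `G ⧸ N` by right translation; a quotient of `Γ_K` by an
open subgroup is finite).  §1 `tensorReading ι₇ ιC : ℚ₇ ⊗_ℤ K̄ →ₐ[ℤ] ℂ` and its `ℤ₇`-semilinearity.  §2 `levelOf`,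
`torsionExp`, `torsionLayerAt` (+ `_le`, `isOpen`, `isRayClassLayer`, finiteness).  §3 `readingSum` (the un-normalised sum on
`H¹(U_n, T)`), `valOf`.  §4 ★ the laws `valOf_C_smul` (e1′), `readingSum_conjMap` (χ⁻¹-equivariance), `valOf_T_smul` (e1).  The companion file
`RamifiedSevenGenusKatoExpReadingValues.lean` proves (eV) `valOf_euK` and (e2) `valOf_piK_of_expStarCM` (from the `𝔏`-form
«`𝔏_{U′}(φ_* c) = (1 ⊗ √−7)·𝔏_{U′}(c)`», Kato 15.14).

HONEST LABEL: a term and kernel theorems about it; (e2) is REDUCED to a hypothesis on the abstract datum `Φ.𝔏` (the road-D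
definition row), not proved; (eZ) is not touched; no stub is closed; stmt-BirchSwinnertonDyer-19945 OPEN (4 sorries);
`X12.CMRamifiedSeven` NOT proved; no summit statement is proved by this seat; BSD is claimed for no curve.

References: K. Kato, Astérisque 295 (2004) Prop. 15.9 / (15.9.1) (pp. 258–259), §15.8 (15.8.1) (p. 257), (15.12.2) (p. 263),
15.14 (p. 264), Thm. 12.5 (1) (p. 221) [Kato2004Asterisque]; J. Neukirch, A. Schmidt, K. Wingberg (2008) I §5 (1.5.4),
(1.5.6)–(1.5.7) (res, cor, conjugation) [NeukirchSchmidtWingberg2008]; J.-P. Serre, *Local Fields* VII §5 [SerreLocalFields1979];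
S. Bloch, K. Kato (1990) Def. 3.10 [BlochKato1990]; tree (C6-R) p800949, (P1) p776025, (L) p776319, `EllipticZetaReciprocity`,
`IwasawaCohomologyNumberField`, `ContinuousCorestrictionResNormal`, `IwasawaCohomologyNumberFieldTwistModel`.
-/

noncomputable section

open scoped NumberField TensorProduct
open Field IsDedekindDomain NumberField
open Literature.NumberTheory.GaloisRepresentations
open Literature.NumberTheory.EllipticCurves
open Literature.NumberTheory.EllipticCurves.Rank1Residual
open Literature.NumberTheory.EllipticCurves.IwasawaAlgebra
open Literature.NumberTheory.EllipticCurves.Kato2004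
open Literature.NumberTheory.ComplexMultiplication.EllipticUnits
open Summit.BirchSwinnertonDyer.Rank1Residual

namespace Summit.BirchSwinnertonDyer.Rank1Residual.Additive.GenusSeven

/-! ## §0 Helpers: sums over a finite quotient `G ⧸ N` -/

section Quotient

variable {G : Type*} [Group G] (N : Subgroup G) [N.Normal]

/-- **Re-indexing a sum over `G ⧸ N` by right translation**: for `F : G → ℂ` invariant under right multiplication by
`N` and any `g₀ ∈ G`, `Σ_{q ∈ G/N} F(q̃·g₀) = Σ_{q ∈ G/N} F(q̃)` (`q̃ = q.out`; the map `q ↦ q·ḡ₀` is a bijection of the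
group `G ⧸ N` and `F` descends). [cite: SerreLocalFields1979, VII §5] -/
theorem finsum_quotient_out_mul_right (F : G → ℂ) (hF : ∀ (g : G), ∀ n ∈ N, F (g * n) = F g) (g₀ : G) :
    ∑ᶠ q : G ⧸ N, F (q.out * g₀) = ∑ᶠ q : G ⧸ N, F q.out := by
  have hdesc : ∀ g : G, F ((g : G ⧸ N).out) = F g := fun g => by
    obtain ⟨h, hh⟩ := QuotientGroup.mk_out_eq_mul N g
    rw [hh, hF g h h.2]
  have hstep : ∀ q : G ⧸ N, F (q.out * g₀) = F ((q * (g₀ : G ⧸ N) : G ⧸ N).out) := fun q => by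
    conv_rhs => rw [← QuotientGroup.out_eq' q, ← QuotientGroup.mk_mul, hdesc]
  simp_rw [hstep]
  exact finsum_eq_of_bijective (fun q : G ⧸ N => q * (g₀ : G ⧸ N)) (Group.mulRight_bijective _) fun _ => rfl

/-- `Finset` form of `finsum_quotient_out_mul_right`. [cite: SerreLocalFields1979, VII §5] -/
theorem sum_quotient_out_mul_right [Fintype (G ⧸ N)] (F : G → ℂ) (hF : ∀ (g : G), ∀ n ∈ N, F (g * n) = F g) (g₀ : G) :
    ∑ q : G ⧸ N, F (q.out * g₀) = ∑ q : G ⧸ N, F q.out := by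
  rw [← finsum_eq_sum_of_fintype, ← finsum_eq_sum_of_fintype]
  exact finsum_quotient_out_mul_right N F hF g₀

/-- `v·t = u⁻¹·(v·u·t)` for units `u, v` of `ℂ` (bookkeeping, kept out of goals whose types contain products). [folklore] -/
private theorem units_mul_aux (u v : ℂˣ) (t : ℂ) : (v : ℂ) * t = ((u⁻¹ : ℂˣ) : ℂ) * ((v : ℂ) * (u : ℂ) * t) := by
  rw [mul_assoc, mul_left_comm (v : ℂ), Units.inv_mul_cancel_left]

end Quotient

section AbsGalois

variable {L : Type} [Field L]

/-- An open subgroup of `Γ_L` has a FINITE coset space (`Γ_L` is compact). [cite: SerreLocalFields1979, VII §5] -/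
theorem finite_quotient_of_isOpen (U : Subgroup (absoluteGaloisGroup L)) (hU : IsOpen (U : Set (absoluteGaloisGroup L))) :
    Finite (absoluteGaloisGroup L ⧸ U) := by
  haveI : CompactSpace (absoluteGaloisGroup L) := absoluteGaloisGroup_compactSpace L
  haveI := finiteIndex_of_isOpen_of_compactSpace U hU
  infer_instance

/-- For `U′ ≤ U` with `U′` open in `Γ_L`: the relative coset space `U ⧸ U′` is finite. [cite: SerreLocalFields1979, VII §5] -/
theorem finite_quotient_subgroupOf_of_isOpen (U U' : Subgroup (absoluteGaloisGroup L))
    (hU' : IsOpen (U' : Set (absoluteGaloisGroup L))) : Finite (U ⧸ U'.subgroupOf U) := by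
  haveI : CompactSpace (absoluteGaloisGroup L) := absoluteGaloisGroup_compactSpace L
  haveI := finiteIndex_of_isOpen_of_compactSpace U' hU'
  infer_instance

end AbsGalois

/-! ## §1 The complex reading `ι₇ ⊗ ιC` of the value module `ℚ₇ ⊗_ℤ K̄` -/

section Reading

variable {L : Type} [Field L]

/-- **`tensorReading ι₇ ιC : ℚ₇ ⊗_ℤ K̄ → ℂ`, `a ⊗ b ↦ ι₇(a)·ιC(b)`** — the complex reading of Kato's value module
`S(ψ) ⊗_K K′ ↪ ℚ₇ ⊗ K̄` through a `7`-adic reading `ι₇` and the complex embedding `ιC` (a ring homomorphism).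
[cite: Kato2004Asterisque, §15.8 (15.8.1) (p. 257) and Prop. 15.9 (p. 258)] -/
def tensorReading (ι₇ : ℚ_[7] →+* ℂ) (ιC : AlgebraicClosure L →+* ℂ) : ℚ_[7] ⊗[ℤ] AlgebraicClosure L →ₐ[ℤ] ℂ :=
  Algebra.TensorProduct.lift ι₇.toIntAlgHom ιC.toIntAlgHom fun _ _ => Commute.all _ _

/-- `tensorReading` on pure tensors. [cite: Kato2004Asterisque, §15.8 (15.8.1) (p. 257)] -/
@[simp] theorem tensorReading_tmul (ι₇ : ℚ_[7] →+* ℂ) (ιC : AlgebraicClosure L →+* ℂ) (a : ℚ_[7])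
    (b : AlgebraicClosure L) : tensorReading ι₇ ιC (a ⊗ₜ[ℤ] b) = ι₇ a * ιC b := by
  rw [tensorReading, Algebra.TensorProduct.lift_tmul]
  rfl

/-- **`ℤ₇`-semilinearity of the reading**: `(ι₇ ⊗ ιC)(c·t) = ι₇(c)·(ι₇ ⊗ ιC)(t)` for `c ∈ ℤ₇` acting on the left factor.
[cite: Kato2004Asterisque, Thm. 12.5 (1) (p. 221)] -/
theorem tensorReading_smul (ι₇ : ℚ_[7] →+* ℂ) (ιC : AlgebraicClosure L →+* ℂ) (c : ℤ_[7])
    (t : ℚ_[7] ⊗[ℤ] AlgebraicClosure L) :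
    tensorReading ι₇ ιC (c • t) = ι₇ (c : ℚ_[7]) * tensorReading ι₇ ιC t := by
  induction t using TensorProduct.induction_on with
  | zero => simp
  | tmul a b =>
    rw [TensorProduct.smul_tmul', tensorReading_tmul, tensorReading_tmul, Algebra.smul_def, map_mul, mul_assoc]
    rfl
  | add x y hx hy => rw [smul_add, map_add, map_add, hx, hy, mul_add]

end Reading

/-! ## §2 The levels read by `valOf`: the least cyclotomic level of `χ` and the torsion layer inside it -/

section Frame

variable {W : WeierstrassCurve ℚ} [W.IsElliptic] [W.IsGloballyMinimal] [Fact (Nat.Prime 7)]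
  [ContinuousSMul ℤ_[7] (W.tateModule 7)] {K : ZpExtension ℚ 7} {hK : K.IsCyclotomic}
  {γ : Field.absoluteGaloisGroup ℚ} {I : IwasawaH1Data W 7 K γ}
  {F : GenusFrame} {θu : ∀ n : ℕ, globalUnitsOf (F.layer n)} {d : GenusDatum F θu}

namespace PinnedKatoGenusFrame

variable (Φ : PinnedKatoGenusFrame W K hK I d)

/-- **`towerK Φ`**: the cyclotomic `ℤ₇`-tower `Kℚ_∞/K` of the CM field — the tree's `K.restrictOfFinrankEqTwo _ Φ.Kcm _`
(an `abbrev`, so that the proof of `7 ≠ 2` is written once). [cite: Kato2004Asterisque, 15.14 (p. 264, "K ⊂ ℚ(ζ_{p^∞})")] -/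
abbrev towerK : ZpExtension Φ.Kcm 7 := K.restrictOfFinrankEqTwo (by decide) Φ.Kcm Φ.finrank_Kcm

open scoped Classical in
/-- **`levelOf Φ χ = n(χ)`**: the least `n` with `χ` trivial on `U_n = Gal(K̄/Kℚ_n)` (a character of `Gal(Kℚ_n/K)`);
`0` if `χ` has no finite cyclotomic level (then no field of the datum constrains `val χ`).
[cite: Kato2004Asterisque, Prop. 15.9 (p. 258, "characters of Gal(K′/K)")] -/
def levelOf (χ : absoluteGaloisGroup Φ.Kcm →ₜ* ℂˣ) : ℕ :=
  if h : ∃ n : ℕ, ∀ σ ∈ Φ.towerK.layerSubgroup n, χ σ = 1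
  then Nat.find h else 0

open scoped Classical in
/-- `χ` is trivial on `U_{n(χ)}` as soon as it is trivial on some `U_n`. [cite: Kato2004Asterisque, Prop. 15.9 (p. 258)] -/
theorem levelOf_spec (χ : absoluteGaloisGroup Φ.Kcm →ₜ* ℂˣ) {n : ℕ}
    (hχ : ∀ σ ∈ Φ.towerK.layerSubgroup n, χ σ = 1) :
    ∀ σ ∈ Φ.towerK.layerSubgroup (Φ.levelOf χ), χ σ = 1 := by
  have h : ∃ n : ℕ, ∀ σ ∈ Φ.towerK.layerSubgroup n, χ σ = 1 :=
    ⟨n, hχ⟩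
  rw [levelOf, dif_pos h]
  exact Nat.find_spec h

/-- **`torsionExp Φ n = m(n)`**: an exponent with `Gal(K̄/K(W_K[7^m·7d])) ≤ U_n` (the frame's pin `isRayClassLayer_layer`:
the cyclotomic layer `Kℚ_n` lies in the ray class field `K(7^m·(7d))`). [cite: Kato2004Asterisque, §15.3 (15.3.1)–(15.3.3) (p. 252) and 15.14 (p. 264)] -/
def torsionExp (n : ℕ) : ℕ := Classical.choose (Φ.isRayClassLayer_layer n).2

/-- **`torsionLayerAt Φ n = U′_n := Gal(K̄/K(W_K[7^{m(n)}·7d]))`**, the torsion layer of the two-variable tower read inside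
`U_n`. [cite: Kato2004Asterisque, §15.3 (15.3.3) (p. 252)] [cite: Kato1993Trento, Chap. III §1.2.2] -/
abbrev torsionLayerAt (n : ℕ) : Subgroup (absoluteGaloisGroup Φ.Kcm) :=
  CM.torsionLayer (W.baseChange Φ.Kcm) (7 ^ Φ.torsionExp n * (7 * F.d))

/-- `U′_n ≤ U_n`. [cite: Kato2004Asterisque, §15.3 (p. 252) and 15.14 (p. 264)] -/
theorem torsionLayerAt_le (n : ℕ) :
    Φ.torsionLayerAt n ≤ Φ.towerK.layerSubgroup n :=
  Classical.choose_spec (Φ.isRayClassLayer_layer n).2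

/-- `U′_n` is open (the mod-`m` representation of an elliptic curve is continuous, `m ≠ 0`). [cite: SilvermanAEC2009, III.§7] -/
theorem isOpen_torsionLayerAt (n : ℕ) : IsOpen (Φ.torsionLayerAt n : Set (absoluteGaloisGroup Φ.Kcm)) := by
  have h7 : (7 : ℕ) ≠ 0 := by decide
  have hne' : 7 ^ Φ.torsionExp n * (7 * F.d) ≠ 0 := mul_ne_zero (pow_ne_zero _ h7) (mul_ne_zero h7 F.d_ne_zero)
  have hne : ((7 ^ Φ.torsionExp n * (7 * F.d) : ℕ) : ℤ) ≠ 0 := by exact_mod_cast hne'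
  exact (W.baseChange Φ.Kcm).isOpen_ker_galoisRepTorsion_holds hne

/-- `U′_n` is a ray-class layer of modulus `7·(7d)` (for the body's (Z1), (Z4), (Z5)). [cite: Kato2004Asterisque, §15.1 (p. 250) and Prop. 15.9 (p. 258)] -/
theorem isRayClassLayer_torsionLayerAt (n : ℕ) :
    CM.IsRayClassLayer (W.baseChange Φ.Kcm) 7 (7 * F.d) (Φ.torsionLayerAt n) :=
  CM.isRayClassLayer_torsionLayer _ 7 (7 * F.d) (Φ.torsionExp n) (Φ.isOpen_torsionLayerAt n)

/-- `Γ_{Kcm} ⧸ U′_n` is finite. [cite: SerreLocalFields1979, VII §5] -/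
theorem finite_quotient_torsionLayerAt (n : ℕ) : Finite (absoluteGaloisGroup Φ.Kcm ⧸ Φ.torsionLayerAt n) :=
  finite_quotient_of_isOpen _ (Φ.isOpen_torsionLayerAt n)

/-- `U_n ⧸ U′_n` is finite. [cite: SerreLocalFields1979, VII §5] -/
theorem finite_layer_quotient_torsionLayerAt (n : ℕ) :
    Finite (Φ.towerK.layerSubgroup n ⧸
      (Φ.torsionLayerAt n).subgroupOf (Φ.towerK.layerSubgroup n)) :=
  finite_quotient_subgroupOf_of_isOpen _ _ (Φ.isOpen_torsionLayerAt n)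

/-- The index `[U_n : U′_n]` is non-zero (as a complex number). [cite: SerreLocalFields1979, VII §5] -/
theorem index_torsionLayerAt_ne_zero (n : ℕ) :
    ((((Φ.torsionLayerAt n).subgroupOf
        (Φ.towerK.layerSubgroup n)).index : ℕ) : ℂ) ≠ 0 := by
  haveI := Φ.finite_layer_quotient_torsionLayerAt n
  exact_mod_cast Subgroup.index_ne_zero_of_finite

/-! ## §3 The reading: `readingSum` on a layer and `valOf` on `𝐇′(S′_W) = IK.H` -/

/-- **The un-normalised reading on the layer `H¹(U_n, T₇W_K)`**:
`readingSum Φ ι₇ χ n z = Σ_{q ∈ Γ/U′_n} χ(q̃)·(ι₇ ⊗ ιC)(𝔏_{U′_n}(q̃ · res^{U_n}_{U′_n} z))`, `q̃ = q.out` (the Galois action on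
the CLASS, by transport of structure `conjMap`; a `finsum`, the quotient being finite).
[cite: Kato2004Asterisque, (15.9.1) (p. 259) and §15.8 (15.8.1) (p. 257)] [cite: NeukirchSchmidtWingberg2008, I §5] -/
def readingSum (ι₇ : ℚ_[7] →+* ℂ) (χ : absoluteGaloisGroup Φ.Kcm →ₜ* ℂˣ) (n : ℕ)
    (z : H1 (CM.tateRepK (W.baseChange Φ.Kcm) 7)
      (Φ.towerK.layerSubgroup n)) : ℂ :=
  ∑ᶠ q : absoluteGaloisGroup Φ.Kcm ⧸ Φ.torsionLayerAt n,
    ((χ q.out : ℂˣ) : ℂ) *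
      tensorReading ι₇ Φ.ιC (Φ.𝔏 (Φ.torsionLayerAt n)
        (conjMap (CM.tateRepK (W.baseChange Φ.Kcm) 7).toTopRep (Φ.torsionLayerAt n) q.out 1
          (resLe (CM.tateRepK (W.baseChange Φ.Kcm) 7).toTopRep (Φ.torsionLayerAt_le n) 1 z)))

/-- `readingSum` as a `Finset` sum for any finiteness structure on `Γ ⧸ U′_n`. [cite: Kato2004Asterisque, (15.9.1) (p. 259)] -/
theorem readingSum_eq_sum (ι₇ : ℚ_[7] →+* ℂ) (χ : absoluteGaloisGroup Φ.Kcm →ₜ* ℂˣ) (n : ℕ)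
    [Fintype (absoluteGaloisGroup Φ.Kcm ⧸ Φ.torsionLayerAt n)]
    (z : H1 (CM.tateRepK (W.baseChange Φ.Kcm) 7)
      (Φ.towerK.layerSubgroup n)) :
    Φ.readingSum ι₇ χ n z = ∑ q : absoluteGaloisGroup Φ.Kcm ⧸ Φ.torsionLayerAt n,
      ((χ q.out : ℂˣ) : ℂ) *
        tensorReading ι₇ Φ.ιC (Φ.𝔏 (Φ.torsionLayerAt n)
          (conjMap (CM.tateRepK (W.baseChange Φ.Kcm) 7).toTopRep (Φ.torsionLayerAt n) q.out 1
            (resLe (CM.tateRepK (W.baseChange Φ.Kcm) 7).toTopRep (Φ.torsionLayerAt_le n) 1 z))) :=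
  finsum_eq_sum_of_fintype _

/-- `readingSum` is additive in the class. [cite: Kato2004Asterisque, Thm. 12.5 (1) (p. 221)] -/
theorem readingSum_add (ι₇ : ℚ_[7] →+* ℂ) (χ : absoluteGaloisGroup Φ.Kcm →ₜ* ℂˣ) (n : ℕ)
    (z z' : H1 (CM.tateRepK (W.baseChange Φ.Kcm) 7)
      (Φ.towerK.layerSubgroup n)) :
    Φ.readingSum ι₇ χ n (z + z') = Φ.readingSum ι₇ χ n z + Φ.readingSum ι₇ χ n z' := by
  haveI : Fintype (absoluteGaloisGroup Φ.Kcm ⧸ Φ.torsionLayerAt n) :=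
    @Fintype.ofFinite _ (Φ.finite_quotient_torsionLayerAt n)
  simp only [readingSum_eq_sum, map_add, mul_add, Finset.sum_add_distrib]

/-- `readingSum` is `ℤ₇`-semilinear in the class: `c ∈ ℤ₇` comes out as `ι₇(c)` (`res`, `conj`, `𝔏` are `ℤ₇`-linear).
[cite: Kato2004Asterisque, Thm. 12.5 (1) (p. 221)] -/
theorem readingSum_smul (ι₇ : ℚ_[7] →+* ℂ) (χ : absoluteGaloisGroup Φ.Kcm →ₜ* ℂˣ) (n : ℕ) (c : ℤ_[7])
    (z : H1 (CM.tateRepK (W.baseChange Φ.Kcm) 7)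
      (Φ.towerK.layerSubgroup n)) :
    Φ.readingSum ι₇ χ n (c • z) = ι₇ (c : ℚ_[7]) * Φ.readingSum ι₇ χ n z := by
  haveI : Fintype (absoluteGaloisGroup Φ.Kcm ⧸ Φ.torsionLayerAt n) :=
    @Fintype.ofFinite _ (Φ.finite_quotient_torsionLayerAt n)
  rw [readingSum_eq_sum, readingSum_eq_sum, Finset.mul_sum]
  refine Finset.sum_congr rfl fun q _ => ?_
  rw [map_smul, map_smul, map_smul, tensorReading_smul]
  ring

/-- **`valOf Φ ι₇ χ : IK.H →+ ℂ` — THE `exp*`-VALUE READING of the pinned frame** (module docstring «The reading»):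
`x ↦ [U_{n(χ)} : U′_{n(χ)}]⁻¹ · readingSum Φ ι₇ χ n(χ) (IK.proj n(χ) x)`.  This is the TERM inhabiting the field `val` of
`KatoExpDatum hγ Φ`. [cite: Kato2004Asterisque, Prop. 15.9 / (15.9.1) (pp. 258–259), Thm. 12.5 (1) (p. 221)]
[cite: BlochKato1990, Def. 3.10 (p. 359)] -/
def valOf (ι₇ : ℚ_[7] →+* ℂ) (χ : absoluteGaloisGroup Φ.Kcm →ₜ* ℂˣ) : Φ.IK.H →+ ℂ :=
  AddMonoidHom.mk'
    (fun x => ((((Φ.torsionLayerAt (Φ.levelOf χ)).subgroupOf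
        (Φ.towerK.layerSubgroup (Φ.levelOf χ))).index : ℕ) : ℂ)⁻¹ *
      Φ.readingSum ι₇ χ (Φ.levelOf χ) (Φ.IK.proj (Φ.levelOf χ) x))
    fun x y => by rw [map_add, readingSum_add, mul_add]

/-- Unfolding `valOf`. [cite: Kato2004Asterisque, (15.9.1) (p. 259)] -/
theorem valOf_apply (ι₇ : ℚ_[7] →+* ℂ) (χ : absoluteGaloisGroup Φ.Kcm →ₜ* ℂˣ) (x : Φ.IK.H) :
    Φ.valOf ι₇ χ x = ((((Φ.torsionLayerAt (Φ.levelOf χ)).subgroupOf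
        (Φ.towerK.layerSubgroup (Φ.levelOf χ))).index : ℕ) : ℂ)⁻¹ *
      Φ.readingSum ι₇ χ (Φ.levelOf χ) (Φ.IK.proj (Φ.levelOf χ) x) :=
  rfl

/-! ## §4 The value laws -/

/-- ★ (e1′) **`ℤ₇`-LINEARITY**: `valOf χ ((C c)·x) = ι₇(c)·valOf χ x` for `c ∈ ℤ₇` (constants act through the `ℤ₇`-structure of
the layers, `IK.proj_C_smul`). [cite: Kato2004Asterisque, Thm. 12.5 (1) (p. 221)] -/
theorem valOf_C_smul (ι₇ : ℚ_[7] →+* ℂ) (χ : absoluteGaloisGroup Φ.Kcm →ₜ* ℂˣ) (c : ℤ_[7]) (x : Φ.IK.H) :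
    Φ.valOf ι₇ χ ((PowerSeries.C c : IwasawaAlgebra 7) • x) = ι₇ (c : ℚ_[7]) * Φ.valOf ι₇ χ x := by
  rw [valOf_apply, valOf_apply, Φ.IK.proj_C_smul, readingSum_smul]
  ring

/-- **The reading is `χ⁻¹`-EQUIVARIANT under the Galois action on the class**: for `χ` trivial on `U_n` and any `g ∈ Γ_K`,
`readingSum χ n (g · z) = χ(g)⁻¹ · readingSum χ n z` (`res ∘ conj_g = conj_g ∘ res`, `conj_{q̃} ∘ conj_g = conj_{q̃g}`, and
re-indexing `Γ/U′_n` by right translation by `g`; inner classes act trivially). [cite: NeukirchSchmidtWingberg2008, I §5 (1.5.4)]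
[cite: SerreLocalFields1979, VII §5 Prop. 3] -/
theorem readingSum_conjMap (ι₇ : ℚ_[7] →+* ℂ) (χ : absoluteGaloisGroup Φ.Kcm →ₜ* ℂˣ) (n : ℕ)
    (hχ : ∀ σ ∈ Φ.towerK.layerSubgroup n, χ σ = 1) (g : absoluteGaloisGroup Φ.Kcm)
    (z : H1 (CM.tateRepK (W.baseChange Φ.Kcm) 7) (Φ.towerK.layerSubgroup n)) :
    Φ.readingSum ι₇ χ n (conjMap (CM.tateRepK (W.baseChange Φ.Kcm) 7).toTopRep (Φ.towerK.layerSubgroup n) g 1 z) =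
      ((((χ g)⁻¹ : ℂˣ)) : ℂ) * Φ.readingSum ι₇ χ n z := by
  haveI : Fintype (absoluteGaloisGroup Φ.Kcm ⧸ Φ.torsionLayerAt n) :=
    @Fintype.ofFinite _ (Φ.finite_quotient_torsionLayerAt n)
  set T := (CM.tateRepK (W.baseChange Φ.Kcm) 7).toTopRep with hT
  set r := resLe T (Φ.torsionLayerAt_le n) 1 z with hr
  -- the summand as a right-`U′`-invariant function of the representative
  set Fz : absoluteGaloisGroup Φ.Kcm → ℂ := fun h =>
    ((χ h : ℂˣ) : ℂ) * tensorReading ι₇ Φ.ιC (Φ.𝔏 (Φ.torsionLayerAt n) (conjMap T (Φ.torsionLayerAt n) h 1 r)) with hFz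
  have hFinv : ∀ (h : absoluteGaloisGroup Φ.Kcm), ∀ u ∈ Φ.torsionLayerAt n, Fz (h * u) = Fz h := by
    intro h u hu
    simp only [hFz]
    rw [map_mul, hχ u (Φ.torsionLayerAt_le n hu), mul_one, conjMap_mul_apply_one,
      conjMap_one_apply_of_mem T (Φ.torsionLayerAt n) ⟨u, hu⟩ r]
  rw [readingSum_eq_sum, readingSum_eq_sum]
  calc ∑ q : absoluteGaloisGroup Φ.Kcm ⧸ Φ.torsionLayerAt n, ((χ q.out : ℂˣ) : ℂ) *
        tensorReading ι₇ Φ.ιC (Φ.𝔏 (Φ.torsionLayerAt n) (conjMap T (Φ.torsionLayerAt n) q.out 1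
          (resLe T (Φ.torsionLayerAt_le n) 1 (conjMap T (Φ.towerK.layerSubgroup n) g 1 z))))
      = ∑ q : absoluteGaloisGroup Φ.Kcm ⧸ Φ.torsionLayerAt n, ((((χ g)⁻¹ : ℂˣ)) : ℂ) * Fz (q.out * g) := by
        refine Finset.sum_congr rfl fun q _ => ?_
        simp only [hFz]
        rw [Kato2004.resLe_conjMap T (Φ.torsionLayerAt_le n) g z, ← hr, ← conjMap_mul_apply_one, map_mul,
          Units.val_mul]
        exact units_mul_aux (χ g) (χ q.out) _
    _ = ((((χ g)⁻¹ : ℂˣ)) : ℂ) * ∑ q : absoluteGaloisGroup Φ.Kcm ⧸ Φ.torsionLayerAt n, Fz q.out := by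
        rw [← Finset.mul_sum, sum_quotient_out_mul_right (Φ.torsionLayerAt n) Fz hFinv g]

/-- ★ (e1) **NATURALITY under `γK`**: `valOf χ ((1+X)·x) = χ(γK)⁻¹ · valOf χ x` for every `χ` of finite level and EVERY class
`x` (`X` acts as `conj_{γK} − 1` on the layers, `IK.proj_T_smul`; then `readingSum_conjMap`).
[cite: Kato2004Asterisque, Thm. 12.5 (1) (p. 221) and (15.12.2) (p. 263)] [cite: NeukirchSchmidtWingberg2008, I §5 (1.5.4)] -/
theorem valOf_T_smul (ι₇ : ℚ_[7] →+* ℂ) (χ : absoluteGaloisGroup Φ.Kcm →ₜ* ℂˣ)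
    (hχ : ∃ n : ℕ, ∀ σ ∈ Φ.towerK.layerSubgroup n, χ σ = 1) (x : Φ.IK.H) :
    Φ.valOf ι₇ χ ((1 + PowerSeries.X : IwasawaAlgebra 7) • x) = (((χ Φ.γK)⁻¹ : ℂˣ) : ℂ) * Φ.valOf ι₇ χ x := by
  obtain ⟨n₀, hn₀⟩ := hχ
  have hlev := Φ.levelOf_spec χ hn₀
  have hproj : Φ.IK.proj (Φ.levelOf χ) ((1 + PowerSeries.X : IwasawaAlgebra 7) • x) =
      conjMap (CM.tateRepK (W.baseChange Φ.Kcm) 7).toTopRep (Φ.towerK.layerSubgroup (Φ.levelOf χ)) Φ.γK 1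
        (Φ.IK.proj (Φ.levelOf χ) x) := by
    rw [add_smul, one_smul, map_add, Φ.IK.proj_T_smul, add_sub_cancel]
  rw [valOf_apply, valOf_apply, hproj, Φ.readingSum_conjMap ι₇ χ _ hlev]
  ring

end PinnedKatoGenusFrame

end Frame

end Summit.BirchSwinnertonDyer.Rank1Residual.Additive.GenusSeven

end
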